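import Summits.QuantumFields.YangMills.Theorems.BalabanUVNodesN12FlatDatumRigidityNestedPrelim
import HarnessLib

/-!
# BalabanUVNodes ∕ N12 — RIGIDITY AT THE FLAT DATUM FOR EVERY SEPARATED NESTED BLOCK-UNION SEQUENCE `{Ω_j}_{j ≤ k}` (the determining set (2.2) `genSet Ω k`), not only for the
# record's maximal sequence `𝐁_k(Z)`: a holonomy-flat configuration with trivial straight transporters on the constrained bonds is `1^{u}` with `u = 1` AT EVERY TOWER SITE

[Balaban1985Variational] = «[15]», Thm 1 p. 279 («a unique critical orbit in the space (6)»), (1) p. 277 («Ω_j is a union of big blocks»), (3)–(4) p. 278 (the group (4)); [Balaban1988Convergent]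
= «[III]», (2.1)–(2.2) pp. 254–255, (2.10)–(2.13) pp. 256–257; [Balaban1985RegularSpaces] (1.3)–(1.6) p. 77 (the collar `dist(Ω_n, Ω_{n−1}ᶜ) ≥ LⁿξM₁`); [Balaban1987RG1] (0.1)–(0.4) pp. 251–253;
[Balaban1985Averaging] (8), (11) pp. 18–19; [Balaban1984PropagatorsI] (1.7) p. 18; I. Montvay, G. Münster, *Quantum fields on a lattice* (1994) (3.124)–(3.125) [MontvayMunster1994].

Cell `pub-ymgap` (HUMAN RULINGS D-0062 ∕ D-0149), lane `pub-ymgap-dag-n12-c` g30 (R134 seat (a), N12 = [B15], s1, LANE OWNER; key K1⁹ `stmt-QuantumFields-27364`,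
`--kind proof --supports …`; count-neutral).  THEOREMS ONLY (0 `def`, 0 `instance`, 0 `sorry`).  Consumed BY NAME: dag-n12-w6 g17's `…N12FlatDatumRigidity(Prelim)` (the comb gauge, the
word calculus, the in-block segment walks — everything there that does not read the maximal sequence), dag-n12-w3's `…N12BlockChains.exists_blockWalk_centre`, r12's `B14.Eq22Determines`
(`blockIter`, `IsBlockUnion`), r13's `B16Sect1Backgrounds` (`toMS`, `gaugeAct_gaugeAct`).

WHY (the lane's g30 audit of its own (E∕U) named fact `B11Thm1ExistsUniqueCoP7M(G).VariationalThm1EUSepCoP7M(G)`, cell bus 2026-08-29 «AUDIT-CLEAN»).  The fact's uniqueness clause — any two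
(2.12) minimisers differ by a gauge transformation TOWER-CENTRAL on the constrained bonds — is quantified over ALL separated (2.18) indices `s` (`0 < k`) and ALL data, in particular the
FLAT datum `M˙(1)`.  There dag-n12-w1 g4's twist obstruction (`…N12Thm1CentralLetterTwistObstruction`) makes the clause fail exactly when the tower-site constraint graph is disconnected
(its LOCATED-3, «plausibly connected — NOT proved»), and dag-n12-w6 g17 proved the clause at the flat datum for the RECORD's determining set `𝐁_k(Z)` (`…N12FlatDatumRigidity`, levels from
the maximal sequence `Ω_n(Z)`).  THIS FILE proves it for EVERY nested sequence `{Ω_j}_{1 ≤ j ≤ k}` of unions of `j`-blocks with print's one-collar separation — the full index range of the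
named fact — under three DISPLAYED hypotheses on `Ω` (discharged for r11's (2.18) indices of the torus class and of record in the sibling `…N12Thm1EUAtFlatDatumAllIndices`):
  (N) `Ω_{j+1} ⊆ Ω_j` (`1 ≤ j < k`);  (B) `Ω_j` is a union of `j`-blocks (`1 ≤ j ≤ k`; `B14.Eq22Determines.IsBlockUnion`);
  (S) the ONE-BLOCK COLLAR: for `1 ≤ j`, `j + 1 ≤ k`, a fine site `x` adjacent to a site of `Ω_{j+1}` has its whole `(j+1)`-block inside `Ω_j` ([6] (1.3)–(1.6): one layer of
      `L^{j+1}M₁`-cubes around `Ω_{j+1}` lies in `Ω_j`, `M₁ ≥ 1`).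

THE THEOREM (★★★ `exists_gauge_eq_one_on_towers_of_flat_segments_genSet`; generic `P : Params`, generic `GaugeGroup G`, `1 ≤ k ≤ m + K`, the letter budget `(d+3)Lᵏ ≤ |T_η|`): under
(N)(B)(S), a HOLONOMY-FLAT `U` with TRIVIAL STRAIGHT TRANSPORTERS on the constrained bonds of `genSet Ω k` is `1^{u}` with `u = 1` at the two tower sites of every constrained bond; ★★★
`exists_towerCentral_gauge_of_flat_segments_genSet` (two such configurations are tower-centrally — indeed tower-trivially — gauge related); ★★ `…_to_one_genSet`.  PROOF = w6's verbatim
with the maximal-sequence facts replaced by (N)(B)(S): PART 1 (`…N12FlatDatumRigidityNestedPrelim`) carries the levels (`exists_level_genSet`, `level_unique_genSet`,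
`levels_near_of_shift_genSet`, `mem_genSet_of_blockOf_eq_outerBlock`) and the local chain words (same ∕ up ∕ down); this file is the comb gauge.  No divisibility row is read here (it enters only the discharge of (B)(S) for cube classes).

HONEST FRAMING.  A rigidity theorem for FLAT fibre configurations (lattice combinatorics + word calculus, by name over landed kernel theorems); it inhabits the uniqueness clause of the
(E∕U) named fact at ONE datum (non-vacuity over the fact's full index range), nothing of Bałaban's estimates; the named fact itself stays WITHOUT producer; count-neutral helper; N12 NOT
discharged; K1⁹ NOT closed; counts of record unmoved; one finite 𝕋⁴ programme at fixed ε — R4 closes the conditional rung `BalabanLadder.UV` only; the Yang–Mills mass gap (Clay) is NOT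
proved by any of this; nothing continuum ∕ ℝ⁴ ∕ OS.
-/

namespace Summit.QuantumFields.YangMills.BalabanUVNodes.N12FlatDatumRigidityNested

open Set
open Literature.MathematicalPhysics.QuantumFieldTheory.Balaban1983to89
open B15DeterminingSets (DetSet pts mem_pts bondsOf embIter genSet gammaRegion_zero gammaRegion_mid gammaRegion_self pts_zero)
open B14.Eq22Determines (blockIter blockIter_zero blockIter_succ IsBlockUnion)
open B15Eq112TorusCover (cover lift cover_lift)
open T4Continuum (walk walkEnd holAt netDisp Letter LStep wordRev walk_append walkEnd_append holAt_append holAt_walk_wordRev wordRev_replicate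
  netDisp_wordRev holAt_nil holAt_cons netDisp_cons walkEnd_apply walkEnd_walkEnd_wordRev holAt_gaugeAct_walk)
open T4ReflectionCone (netDisp_append netDisp_replicate)
open B7Prop1Explicit (treeWord treeWord_zero)
open B16Sect1Backgrounds (toMS mulG gaugeAct_gaugeAct)
open Summit.QuantumFields.YangMills.Theorems.Prop7FlatHolonomy (holAt_walk_append holAt_walk_single_true)
open Summit.QuantumFields.YangMills.BalabanUVNodes.N12BlockChains (blockOf_shift_or exists_blockWalk_centre embIter_shift_eq_walkEnd)
open Summit.QuantumFields.YangMills.Theorems.N21ReadSetSupport (blockIter_embIter)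
open Summit.QuantumFields.YangMills.BalabanUVNodes.N12TowerSiteGraphConnectedBjPrelim (blockIter_shift_or)
open Summit.QuantumFields.YangMills.BalabanUVNodes.N12FlatDatumRigidityPrelim (natAbs_netDisp_le_length netDisp_eq_zero_of_walkEnd_eq walkEnd_treeWord_liftSub
  natAbs_netDisp_treeWord_liftSub_le holAt_walk_segments_eq_one walkEnd_segments natAbs_netDisp_segments_le segments_budget_le)
open Summit.QuantumFields.YangMills.BalabanUVNodes.N12FlatDatumRigidity (holAt_gaugeAct_one_walk holAt_comb_eq_one_of_eq)

open Summit.QuantumFields.YangMills.BalabanUVNodes.N12FlatDatumRigidityNestedPrelim (exists_level_genSet level_unique_genSet exists_chainWord_of_shift)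
variable {P : Params} {k : ℕ} {Ω : ℕ → Set (Site P 0)}

/-! ## §1  The rigidity theorem for `genSet Ω k` (w6's comb gauge, verbatim but for the level ∕ chain-word inputs) -/

section Rigidity

variable {G : Type*} [GaugeGroup G]

/-- ★★★ **RIGIDITY AT THE FLAT DATUM FOR EVERY SEPARATED NESTED BLOCK-UNION SEQUENCE.**  Under (N)(B)(S), `1 ≤ k ≤ m + K` and the letter budget `(d+3)Lᵏ ≤ |T_η|`: a HOLONOMY-FLAT
configuration `U` whose straight transporters along the constrained bonds of `genSet Ω k` are trivial is `1^{u}` for a gauge transformation `u` with `u(ι_j c₋) = u(ι_j c₊) = 1` at the tower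
sites of every constrained bond — print's group (4).  Proof: w6's comb gauge `u(x) = U(comb τx → x)⁻¹`; the local closed word «comb · bond · comb⁻¹ · chain⁻¹» has zero net displacement by
the letter budget, so holonomy-flatness gives `U = 1^{u}`; `u = 1` at the `Γ`-ends (empty comb, `level_unique_genSet`) and at the other ends by (8) telescoped along the trivial segment.
[cite: Balaban1985Variational, Thm 1 p.279, (3)–(4) p.278; Balaban1988Convergent, (2.2) p.255, (2.10)–(2.13) pp.256–257; Balaban1985Averaging, (8), (11) pp.18–19; MontvayMunster1994, (3.124)-(3.125) p.120] -/
theorem exists_gauge_eq_one_on_towers_of_flat_segments_genSet (hk1 : 1 ≤ k) (hk : k ≤ P.m + P.K)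
    (hnest : ∀ j, 1 ≤ j → j < k → Ω (j + 1) ⊆ Ω j) (hBU : ∀ j, 1 ≤ j → j ≤ k → IsBlockUnion j (Ω j))
    (hsep : ∀ j, 1 ≤ j → j + 1 ≤ k → ∀ (x z : Site P 0) (μ : Fin P.d), (z = x.shift μ ∨ x = z.shift μ) → z ∈ Ω (j + 1) →
      ∀ y : Site P 0, blockIter (j + 1) y = blockIter (j + 1) x → y ∈ Ω j)
    (hfit : (P.d + 3) * P.L ^ k ≤ P.sitesPerDir 0)
    (U : GaugeField P 0 G) (hflat : ∀ (x : Site P 0) (w : List (Letter P.d)), (∀ ν, netDisp w ν = 0) → holAt U (walk x w) = 1)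
    (hseg : ∀ j, j ≤ k → ∀ c ∈ bondsOf (genSet Ω k j), holAt U (walk (embIter j c.src) (List.replicate (P.L ^ j) (c.dir, true))) = 1) :
    ∃ u : GaugeTransf P 0 G, (∀ j, j ≤ k → ∀ c ∈ bondsOf (genSet Ω k j), u (embIter j c.src) = 1 ∧ u (embIter j c.tgt) = 1) ∧ GaugeField.gaugeAct u 1 = U := by
  choose lv hlv using fun x : Site P 0 => exists_level_genSet (Ω := Ω) hk1 hk hBU x
  obtain ⟨τ, hτ⟩ : ∃ τ : Site P 0 → Site P 0, ∀ x, τ x = embIter (lv x) (blockIter (lv x) x) := ⟨_, fun _ => rfl⟩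
  obtain ⟨cw, hcw⟩ : ∃ cw : Site P 0 → List (Letter P.d), ∀ x, cw x = treeWord (fun ν => lift P x ν - lift P (τ x) ν) := ⟨_, fun _ => rfl⟩
  have hcw_end : ∀ x, walkEnd (τ x) (cw x) = x := fun x => by rw [hcw]; exact walkEnd_treeWord_liftSub (τ x) x
  have hcw_nd : ∀ x ν, (netDisp (cw x) ν).natAbs ≤ P.L ^ k - 1 := fun x ν => by
    rw [hcw, hτ]
    have h := natAbs_netDisp_treeWord_liftSub_le ((hlv x).1.trans hk) (blockIter_embIter ((hlv x).1.trans hk) (blockIter (lv x) x)) ν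
    exact le_trans h (Nat.sub_le_sub_right (Nat.pow_le_pow_right P.L_pos (hlv x).1) 1)
  -- ★ THE BOND IDENTITY from the local closed word
  have hbond : ∀ b : PBond P 0, holAt U (walk (τ b.src) (cw b.src)) * U b * (holAt U (walk (τ b.tgt) (cw b.tgt)))⁻¹ = 1 := by
    intro b
    obtain ⟨ω, hωend₀, hωhol₀, hωnd⟩ := exists_chainWord_of_shift hk1 hk hnest hBU hsep hseg b.src b.dir (hlv b.src).1 (hlv b.tgt).1 (hlv b.src).2 (hlv b.tgt).2
    have hωend : walkEnd (τ b.src) ω = τ b.tgt := by rw [hτ, hτ]; exact hωend₀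
    have hωhol : holAt U (walk (τ b.src) ω) = 1 := by rw [hτ]; exact hωhol₀
    have e2 : walkEnd b.tgt (wordRev (cw b.tgt)) = τ b.tgt := by
      have h := walkEnd_walkEnd_wordRev (τ b.tgt) (cw b.tgt); rwa [hcw_end] at h
    have e3 : walkEnd (τ b.tgt) (wordRev ω) = τ b.src := by
      have h := walkEnd_walkEnd_wordRev (τ b.src) ω; rwa [hωend] at h
    have end2 : walkEnd (τ b.src) (cw b.src ++ [(b.dir, true)]) = b.tgt := by rw [walkEnd_append, hcw_end]; rfl
    have end3 : walkEnd (τ b.src) (cw b.src ++ [(b.dir, true)] ++ wordRev (cw b.tgt)) = τ b.tgt := by rw [walkEnd_append, end2, e2]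
    have hclosed : walkEnd (τ b.src) (cw b.src ++ [(b.dir, true)] ++ wordRev (cw b.tgt) ++ wordRev ω) = τ b.src := by
      rw [walkEnd_append, end3, e3]
    have hsmall : ∀ ν, (netDisp (cw b.src ++ [(b.dir, true)] ++ wordRev (cw b.tgt) ++ wordRev ω) ν).natAbs < P.sitesPerDir 0 := by
      intro ν
      rw [netDisp_append, netDisp_append, netDisp_append, netDisp_wordRev, netDisp_wordRev]
      have h1 := hcw_nd b.src ν
      have h2 := hcw_nd b.tgt ν
      have h3 := hωnd ν
      have h4 : (netDisp [((b.dir, true) : Letter P.d)] ν).natAbs ≤ 1 := natAbs_netDisp_le_length _ ν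
      have hLk : 1 ≤ P.L ^ k := Nat.one_le_pow _ _ P.L_pos
      have e : (P.d + 3) * P.L ^ k = (P.d + 1) * P.L ^ k + 2 * P.L ^ k := by ring
      rw [e] at hfit
      have t1 := Int.natAbs_add_le (netDisp (cw b.src) ν + netDisp [((b.dir, true) : Letter P.d)] ν + -netDisp (cw b.tgt) ν) (-netDisp ω ν)
      have t2 := Int.natAbs_add_le (netDisp (cw b.src) ν + netDisp [((b.dir, true) : Letter P.d)] ν) (-netDisp (cw b.tgt) ν)
      have t3 := Int.natAbs_add_le (netDisp (cw b.src) ν) (netDisp [((b.dir, true) : Letter P.d)] ν)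
      rw [Int.natAbs_neg] at t1 t2
      omega
    have hhol := hflat (τ b.src) _ (netDisp_eq_zero_of_walkEnd_eq hclosed hsmall)
    have p1 : holAt U (walk b.src [(b.dir, true)]) = U b := holAt_walk_single_true U b.src b.dir
    have p2 : holAt U (walk b.tgt (wordRev (cw b.tgt))) = (holAt U (walk (τ b.tgt) (cw b.tgt)))⁻¹ := by
      have h := holAt_walk_wordRev U (τ b.tgt) (cw b.tgt); rwa [hcw_end] at h
    have p3 : holAt U (walk (τ b.tgt) (wordRev ω)) = 1 := by
      have h := holAt_walk_wordRev U (τ b.src) ω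
      rw [hωend, hωhol, inv_one] at h
      exact h
    rw [holAt_walk_append U (τ b.src) (cw b.src ++ [(b.dir, true)] ++ wordRev (cw b.tgt)) (wordRev ω), end3, p3, mul_one,
      holAt_walk_append U (τ b.src) (cw b.src ++ [(b.dir, true)]) (wordRev (cw b.tgt)), end2, p2,
      holAt_walk_append U (τ b.src) (cw b.src) [(b.dir, true)], hcw_end, p1] at hhol
    exact hhol
  -- the comb gauge and `1^{u} = U`
  have hU : GaugeField.gaugeAct (fun x => (holAt U (walk (τ x) (cw x)))⁻¹) 1 = U := by
    funext b
    show (holAt U (walk (τ b.src) (cw b.src)))⁻¹ * 1 * ((holAt U (walk (τ b.tgt) (cw b.tgt)))⁻¹)⁻¹ = U b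
    rw [mul_one, inv_inv]
    exact (eq_inv_mul_of_mul_eq (mul_inv_eq_one.mp (hbond b))).symm
  refine ⟨fun x => (holAt U (walk (τ x) (cw x)))⁻¹, ?_, hU⟩
  -- (i) at the `Γ`-ends: the level of `ι_j s` is `j`, the comb is empty
  have hfix : ∀ {j : ℕ}, j ≤ k → ∀ {s : Site P j}, s ∈ genSet Ω k j → (holAt U (walk (τ (embIter j s)) (cw (embIter j s))))⁻¹ = 1 := by
    intro j hj s hs
    have hb : blockIter j (embIter j s) = s := blockIter_embIter (hj.trans hk) s
    have hsj : blockIter j (embIter j s) ∈ genSet Ω k j := by rw [hb]; exact hs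
    have e : lv (embIter j s) = j := level_unique_genSet hk hnest hBU (hlv _).1 hj (hlv _).2 hsj
    have hτs : τ (embIter j s) = embIter j s := by
      rw [hτ]
      revert e
      generalize lv (embIter j s) = n
      intro e
      subst e
      rw [hb]
    rw [hcw, hτs, ← hb]
    rw [holAt_comb_eq_one_of_eq U _ _ (by rw [hb]), inv_one]
  -- (ii) at BOTH ends, by (8) telescoped along the trivial segment of the pure gauge `U = 1^{u}`
  intro j hj c hc
  have hends : (holAt U (walk (τ (embIter j c.src)) (cw (embIter j c.src))))⁻¹ = (holAt U (walk (τ (embIter j c.tgt)) (cw (embIter j c.tgt))))⁻¹ := by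
    have h := hseg j hj c hc
    rw [← hU, holAt_gaugeAct_one_walk, ← embIter_shift_eq_walkEnd] at h
    exact (mul_inv_eq_one.mp h)
  show (holAt U (walk (τ (embIter j c.src)) (cw (embIter j c.src))))⁻¹ = 1 ∧ (holAt U (walk (τ (embIter j c.tgt)) (cw (embIter j c.tgt))))⁻¹ = 1
  rcases (show c.src ∈ genSet Ω k j ∨ c.tgt ∈ genSet Ω k j from hc) with hs | ht
  · exact ⟨hfix hj hs, by rw [← hends]; exact hfix hj hs⟩
  · exact ⟨by rw [hends]; exact hfix hj ht, hfix hj ht⟩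

/-- ★★★ **THE TOWER-CENTRAL CLAUSE BETWEEN TWO FLAT FIBRE CONFIGURATIONS, FOR EVERY SEPARATED NESTED BLOCK-UNION SEQUENCE.**  Under (N)(B)(S): two holonomy-flat configurations with
trivial straight transporters on the constrained bonds of `genSet Ω k` are related `U^u = U₀` by a gauge transformation whose tower restrictions `toMS u j` are EQUAL and CENTRAL (indeed
`= 1`) at the two tower sites of every constrained bond — the uniqueness clause of the lane's named fact `VariationalThm1EUSepTop7M(G)` read at two flat minimisers.
[cite: Balaban1985Variational, Thm 1 p.279, (3)–(4) p.278; Balaban1988Convergent, (2.2) p.255, (2.10)–(2.12) p.256; Balaban1989LargeFieldII, (1.25) p.362] -/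
theorem exists_towerCentral_gauge_of_flat_segments_genSet (hk1 : 1 ≤ k) (hk : k ≤ P.m + P.K)
    (hnest : ∀ j, 1 ≤ j → j < k → Ω (j + 1) ⊆ Ω j) (hBU : ∀ j, 1 ≤ j → j ≤ k → IsBlockUnion j (Ω j))
    (hsep : ∀ j, 1 ≤ j → j + 1 ≤ k → ∀ (x z : Site P 0) (μ : Fin P.d), (z = x.shift μ ∨ x = z.shift μ) → z ∈ Ω (j + 1) →
      ∀ y : Site P 0, blockIter (j + 1) y = blockIter (j + 1) x → y ∈ Ω j)
    (hfit : (P.d + 3) * P.L ^ k ≤ P.sitesPerDir 0) (U U₀ : GaugeField P 0 G)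
    (hflat : ∀ (x : Site P 0) (w : List (Letter P.d)), (∀ ν, netDisp w ν = 0) → holAt U (walk x w) = 1)
    (hseg : ∀ j, j ≤ k → ∀ c ∈ bondsOf (genSet Ω k j), holAt U (walk (embIter j c.src) (List.replicate (P.L ^ j) (c.dir, true))) = 1)
    (hflat₀ : ∀ (x : Site P 0) (w : List (Letter P.d)), (∀ ν, netDisp w ν = 0) → holAt U₀ (walk x w) = 1)
    (hseg₀ : ∀ j, j ≤ k → ∀ c ∈ bondsOf (genSet Ω k j), holAt U₀ (walk (embIter j c.src) (List.replicate (P.L ^ j) (c.dir, true))) = 1) :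
    ∃ u : GaugeTransf P 0 G, (∀ j, j ≤ k → ∀ b ∈ bondsOf (genSet Ω k j),
        toMS u j b.src = toMS u j b.tgt ∧ ∀ g : G, toMS u j b.src * g = g * toMS u j b.src) ∧ GaugeField.gaugeAct u U = U₀ := by
  obtain ⟨u₁, hu₁, hU⟩ := exists_gauge_eq_one_on_towers_of_flat_segments_genSet hk1 hk hnest hBU hsep hfit U hflat hseg
  obtain ⟨u₀, hu₀, hU₀⟩ := exists_gauge_eq_one_on_towers_of_flat_segments_genSet hk1 hk hnest hBU hsep hfit U₀ hflat₀ hseg₀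
  refine ⟨fun x => u₀ x * (u₁ x)⁻¹, fun j hj b hb => ?_, ?_⟩
  · obtain ⟨h1s, h1t⟩ := hu₁ j hj b hb
    obtain ⟨h0s, h0t⟩ := hu₀ j hj b hb
    show u₀ (embIter j b.src) * (u₁ (embIter j b.src))⁻¹ = u₀ (embIter j b.tgt) * (u₁ (embIter j b.tgt))⁻¹ ∧
      ∀ g : G, u₀ (embIter j b.src) * (u₁ (embIter j b.src))⁻¹ * g = g * (u₀ (embIter j b.src) * (u₁ (embIter j b.src))⁻¹)
    rw [h1s, h1t, h0s, h0t]
    exact ⟨rfl, fun g => by simp⟩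
  · rw [← hU, gaugeAct_gaugeAct, ← hU₀]
    congr 1
    funext x
    show u₀ x * (u₁ x)⁻¹ * u₁ x = u₀ x
    rw [inv_mul_cancel_right]

end Rigidity

end Summit.QuantumFields.YangMills.BalabanUVNodes.N12FlatDatumRigidityNested
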